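import Summits.Ventures.PercRepro0.Trif

/-!
# Exterior tails and good face triples (UNIQUENESS-p6-v1 §3.1, §4 Step 3(a) — the selection), seat p6

Kernel-checked twin, on `Defs.lean`, of the first half of the creation argument of Step 3 of the
uniqueness proof (the tripod and Lemma 3.4 are in `Tripod.lean` / `TrifCreate.lean`):

* exterior bonds = bonds not meeting `Λ_n` (`Merge.touching d n`): an exterior connection from a vertex
  outside `Λ_n` stays outside (`notMem_box_of_conn_ext`) and is a connection of `ω^{(v)}` for every
  `v ∈ Λ_n` (`conn_closeAt_of_conn_ext`);
* Lemma 3.1 = `exists_face_connInf_ext`: an infinite cluster meeting `Λ_n` contains a face vertex of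
  `∂Λ_{n+1}` (a vertex outside `Λ_n` adjacent to `Λ_n`) whose EXTERIOR cluster is infinite (pigeonhole over
  the finitely many face vertices, `exists_face_of_walk`);
* face triples `b` (three distinct vertices outside `Λ_n`, each adjacent to a vertex of `Λ_n`) and the
  GOOD event of `b` = «the three vertices `b i` have infinite, pairwise disjoint exterior clusters», an event
  of the exterior bonds only (`measurableSet_good`, `good_of_sdiff_eq`); both are spelled out in full (no
  new definitions);
* the covering `atLeastInf d 3 ⊆ ⋃ n, ⋃ b, {b is a face triple} ∩ (good event of b)` (countable union,
  `atLeastInf_three_subset_iUnion`) and its consequence `exists_good_pos`: `P_p(N ≥ 3) > 0` gives a face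
  triple `b` whose good event has positive probability — this union bound replaces the paper's
  lexicographic measurable selection `s` of Step 3(a).
-/

namespace Summit.Ventures.PercRepro0.ExtTails

open MeasureTheory ProbabilityTheory unitInterval Set Function
open scoped ENNReal
open Summit.Ventures.PercRepro0.Defs
open Summit.Ventures.PercRepro0.L2 (nrm mem_box_iff)
open Summit.Ventures.PercRepro0.Merge (touching mem_box_succ_of_adj)
open Summit.Ventures.PercRepro0.Ergodic (atLeastInf)
open Summit.Ventures.PercRepro0.Trif (closeAt measurable_sdiff_const)

variable {d : ℕ}

/-! ## Exterior bonds -/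

/-- A bond not meeting `Λ_n` has no endpoint in `Λ_n`. -/
theorem notMem_box_of_notMem_touching {n : ℕ} {e : Sym2 (Vertex d)} (he : e ∈ bonds d)
    (hne : e ∉ touching d n) {y : Vertex d} (hy : y ∈ e) : y ∉ box d n :=
  fun hybox => hne ⟨he, y, hy, hybox⟩

/-- A bond at a vertex of `Λ_n` meets `Λ_n`. -/
theorem mem_touching_of_mem {n : ℕ} {e : Sym2 (Vertex d)} (he : e ∈ bonds d) {y : Vertex d}
    (hy : y ∈ e) (hybox : y ∈ box d n) : e ∈ touching d n :=
  ⟨he, y, hy, hybox⟩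

/-- An exterior connection (bonds not meeting `Λ_n`) from a vertex outside `Λ_n` ends outside `Λ_n`. -/
theorem notMem_box_of_conn_ext {ω : Config d} {n : ℕ} {a c : Vertex d}
    (h : Conn d (ω \ touching d n) a c) (ha : a ∉ box d n) : c ∉ box d n := by
  obtain ⟨w, hw⟩ := (conn_iff_exists_walk _ a c).1 h
  clear h
  induction w with
  | nil => exact ha
  | @cons u v c hadj w ih =>
    have he : s(u, v) ∈ ω \ touching d n := hw _ (by simp)
    have hv : v ∉ box d n :=
      notMem_box_of_notMem_touching ((lattice d).mem_edgeSet.2 hadj) he.2 (show v ∈ s(u, v) by simp)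
    exact ih hv fun e he => hw e (by simp [he])

/-- An exterior connection is a connection of `ω^{(v)}` for every `v ∈ Λ_n`. -/
theorem conn_closeAt_of_conn_ext {ω : Config d} {n : ℕ} {v : Vertex d} (hv : v ∈ box d n) {a c : Vertex d}
    (h : Conn d (ω \ touching d n) a c) : Conn d (closeAt ω v) a c := by
  obtain ⟨w, hw⟩ := (conn_iff_exists_walk _ a c).1 h
  refine (conn_iff_exists_walk _ a c).2 ⟨w, fun e he => ?_⟩
  have h1 := hw e he
  refine ⟨h1.1, fun hve => h1.2 ?_⟩
  exact mem_touching_of_mem (w.edges_subset_edgeSet he) hve hv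

/-! ## Lemma 3.1: exterior tails -/

/-- Along a walk of `ω` ending outside `Λ_n`: either some face vertex `b` (outside `Λ_n`, adjacent to
`Λ_n`) is reachable from the start and joined to the end by exterior bonds, or the whole walk stays outside
`Λ_n` and is exterior. -/
theorem exists_face_of_walk {ω : Config d} {n : ℕ} :
    ∀ {a z : Vertex d}, (openGraph d ω).Walk a z → z ∉ box d n →
      (∃ b, (∃ u ∈ box d n, (lattice d).Adj u b) ∧ b ∉ box d n ∧ Conn d ω a b ∧
        Conn d (ω \ touching d n) b z) ∨
      (a ∉ box d n ∧ Conn d (ω \ touching d n) a z) := by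
  intro a z p
  induction p with
  | nil => intro hz; exact Or.inr ⟨hz, SimpleGraph.Reachable.refl _⟩
  | @cons a c z hadj p ih =>
    intro hz
    have hadj' := hadj
    rw [openGraph, SimpleGraph.fromEdgeSet_adj] at hadj'
    have hlat : (lattice d).Adj a c := (lattice d).mem_edgeSet.1 hadj'.1.2
    rcases ih hz with ⟨b, hbu, hbnot, hcb, hbz⟩ | ⟨hcnot, hcz⟩
    · exact Or.inl ⟨b, hbu, hbnot, hadj.reachable.trans hcb, hbz⟩
    · by_cases ha : a ∈ box d n
      · exact Or.inl ⟨c, ⟨a, ha, hlat⟩, hcnot, hadj.reachable, hcz⟩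
      · refine Or.inr ⟨ha, SimpleGraph.Reachable.trans ?_ hcz⟩
        refine SimpleGraph.Adj.reachable ?_
        rw [openGraph, SimpleGraph.fromEdgeSet_adj]
        refine ⟨⟨⟨hadj'.1.1, ?_⟩, hadj'.1.2⟩, hadj'.2⟩
        rintro ⟨_, y, hy, hybox⟩
        rw [Sym2.mem_iff] at hy
        rcases hy with rfl | rfl
        · exact ha hybox
        · exact hcnot hybox

/-- Lemma 3.1: an infinite cluster meeting `Λ_n` contains a face vertex of `∂Λ_{n+1}` (outside `Λ_n`,
adjacent to a vertex of `Λ_n`) whose exterior cluster is infinite. -/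
theorem exists_face_connInf_ext {ω : Config d} {n : ℕ} {x : Vertex d} (hx : x ∈ box d n)
    (hinf : ConnInf d ω x) :
    ∃ b, (∃ u ∈ box d n, (lattice d).Adj u b) ∧ b ∉ box d n ∧ Conn d ω x b ∧
      ConnInf d (ω \ touching d n) b := by
  by_contra hcon
  apply hinf
  -- the face vertices form a finite set (they lie in `Λ_{n+1}`)
  have hfaces : {b : Vertex d | (∃ u ∈ box d n, (lattice d).Adj u b) ∧ b ∉ box d n ∧ Conn d ω x b}.Finite := by
    refine (box_finite (d := d) (n + 1)).subset ?_
    rintro b ⟨⟨u, hu, hub⟩, -, -⟩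
    exact mem_box_succ_of_adj hub hu
  -- every vertex of the cluster outside `Λ_n` lies in the exterior cluster of such a face vertex
  have hfin : (box d n ∪ ⋃ b ∈ {b : Vertex d | (∃ u ∈ box d n, (lattice d).Adj u b) ∧ b ∉ box d n ∧
      Conn d ω x b}, cluster d (ω \ touching d n) b).Finite := by
    refine (box_finite n).union (hfaces.biUnion fun b hb => ?_)
    exact Set.not_infinite.1 fun h => hcon ⟨b, hb.1, hb.2.1, hb.2.2, h⟩
  refine hfin.subset fun y hy => ?_
  by_cases hybox : y ∈ box d n
  · exact Or.inl hybox
  · obtain ⟨p⟩ := hy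
    rcases exists_face_of_walk p hybox with ⟨b, hbu, hbnot, hxb, hby⟩ | ⟨hxnot, -⟩
    · exact Or.inr (Set.mem_biUnion (show b ∈ {b : Vertex d | _} from ⟨hbu, hbnot, hxb⟩) hby)
    · exact absurd hx hxnot

/-! ## Good triples -/

/-! A FACE TRIPLE in `∂Λ_{n+1}` is a `b : Fin 3 → Vertex d` with
`(∀ i, b i ∉ box d n ∧ ∃ u ∈ box d n, (lattice d).Adj u (b i)) ∧ ∀ i j, i ≠ j → b i ≠ b j`
(three distinct vertices outside `Λ_n`, each adjacent to a vertex of `Λ_n`), and the GOOD event of `b` is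
`{ω | (∀ i, ConnInf d (ω \ touching d n) (b i)) ∧ ∀ i j, i ≠ j → ¬ Conn d (ω \ touching d n) (b i) (b j)}`
(«the three vertices `b i` have infinite, pairwise disjoint exterior clusters»); both are written out in
full below (no new definitions). -/

/-- The good event of `b` is measurable. -/
theorem measurableSet_good (n : ℕ) (b : Fin 3 → Vertex d) :
    MeasurableSet {ω : Config d | (∀ i, ConnInf d (ω \ touching d n) (b i)) ∧
      ∀ i j, i ≠ j → ¬ Conn d (ω \ touching d n) (b i) (b j)} := by
  have : {ω : Config d | (∀ i, ConnInf d (ω \ touching d n) (b i)) ∧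
      ∀ i j, i ≠ j → ¬ Conn d (ω \ touching d n) (b i) (b j)} = (fun ω : Config d => ω \ touching d n) ⁻¹'
      ((⋂ i, {ω : Config d | ConnInf d ω (b i)}) ∩
        ⋂ i, ⋂ j, ⋂ (_ : i ≠ j), {ω : Config d | Conn d ω (b i) (b j)}ᶜ) := by
    ext ω
    simp only [Set.mem_setOf_eq, Set.mem_preimage, Set.mem_inter_iff, Set.mem_iInter,
      Set.mem_compl_iff]
  rw [this]
  refine measurable_sdiff_const _ (MeasurableSet.inter ?_ ?_)
  · exact MeasurableSet.iInter fun i => measurableSet_connInf (b i)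
  · exact MeasurableSet.iInter fun i => MeasurableSet.iInter fun j => MeasurableSet.iInter fun _ =>
      (measurableSet_conn (b i) (b j)).compl

/-- The good event depends only on the exterior bonds. -/
theorem good_of_sdiff_eq {n : ℕ} {b : Fin 3 → Vertex d} {ω ω' : Config d}
    (h : ω \ touching d n = ω' \ touching d n)
    (hω : ω ∈ {ω : Config d | (∀ i, ConnInf d (ω \ touching d n) (b i)) ∧
      ∀ i j, i ≠ j → ¬ Conn d (ω \ touching d n) (b i) (b j)}) :
    ω' ∈ {ω : Config d | (∀ i, ConnInf d (ω \ touching d n) (b i)) ∧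
      ∀ i j, i ≠ j → ¬ Conn d (ω \ touching d n) (b i) (b j)} := by
  show (∀ i, ConnInf d (ω' \ touching d n) (b i)) ∧
    ∀ i j, i ≠ j → ¬ Conn d (ω' \ touching d n) (b i) (b j)
  rw [← h]
  exact hω

/-- Covering: a configuration with three distinct infinite clusters has, for some `n` and some face triple
`b` of `∂Λ_{n+1}`, three infinite pairwise disjoint exterior clusters at the `b i`. -/
theorem atLeastInf_three_subset_iUnion :
    atLeastInf d 3 ⊆ ⋃ n : ℕ, ⋃ b : Fin 3 → Vertex d,
      {_ω : Config d | ((∀ i, b i ∉ box d n ∧ ∃ u ∈ box d n, (lattice d).Adj u (b i)) ∧ ∀ i j, i ≠ j → b i ≠ b j)} ∩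
        {ω : Config d | (∀ i, ConnInf d (ω \ touching d n) (b i)) ∧
      ∀ i j, i ≠ j → ¬ Conn d (ω \ touching d n) (b i) (b j)} := by
  rintro ω ⟨x, hx, hxx⟩
  -- a box containing the three vertices
  obtain ⟨n, hxn⟩ : ∃ n : ℕ, ∀ i, x i ∈ box d n :=
    ⟨Finset.univ.sup fun i => nrm (x i), fun i =>
      mem_box_iff.2 (Finset.le_sup (f := fun i => nrm (x i)) (Finset.mem_univ i))⟩
  -- the face vertices of Lemma 3.1
  have hface : ∀ i, ∃ b, (∃ u ∈ box d n, (lattice d).Adj u b) ∧ b ∉ box d n ∧ Conn d ω (x i) b ∧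
      ConnInf d (ω \ touching d n) b := fun i => exists_face_connInf_ext (hxn i) (hx i)
  choose b hbu hbnot hxb hbinf using hface
  refine Set.mem_iUnion.2 ⟨n, Set.mem_iUnion.2 ⟨b, ⟨fun i => ⟨hbnot i, hbu i⟩, fun i j hij heq => ?_⟩,
    hbinf, fun i j hij hc => ?_⟩⟩
  · exact hxx i j hij ((hxb i).trans (heq ▸ (hxb j).symm))
  · exact hxx i j hij ((hxb i).trans ((conn_mono Set.sdiff_subset hc).trans (hxb j).symm))

/-- If `P_p(N ≥ 3) > 0`, some face triple is good with positive probability. -/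
theorem exists_good_pos {p : I} (h3 : 0 < P d p (atLeastInf d 3)) :
    ∃ (n : ℕ) (b : Fin 3 → Vertex d), ((∀ i, b i ∉ box d n ∧ ∃ u ∈ box d n, (lattice d).Adj u (b i)) ∧ ∀ i j, i ≠ j → b i ≠ b j) ∧
      0 < P d p {ω : Config d | (∀ i, ConnInf d (ω \ touching d n) (b i)) ∧
      ∀ i j, i ≠ j → ¬ Conn d (ω \ touching d n) (b i) (b j)} := by
  by_contra hcon
  push Not at hcon
  have hnull : P d p (⋃ n : ℕ, ⋃ b : Fin 3 → Vertex d,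
      {_ω : Config d | ((∀ i, b i ∉ box d n ∧ ∃ u ∈ box d n, (lattice d).Adj u (b i)) ∧ ∀ i j, i ≠ j → b i ≠ b j)} ∩
        {ω : Config d | (∀ i, ConnInf d (ω \ touching d n) (b i)) ∧
      ∀ i j, i ≠ j → ¬ Conn d (ω \ touching d n) (b i) (b j)}) = 0 := by
    refine measure_iUnion_null fun n => measure_iUnion_null fun b => ?_
    by_cases hb : ((∀ i, b i ∉ box d n ∧ ∃ u ∈ box d n, (lattice d).Adj u (b i)) ∧ ∀ i j, i ≠ j → b i ≠ b j)
    · have : {_ω : Config d | ((∀ i, b i ∉ box d n ∧ ∃ u ∈ box d n, (lattice d).Adj u (b i)) ∧ ∀ i j, i ≠ j → b i ≠ b j)} ∩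
          {ω : Config d | (∀ i, ConnInf d (ω \ touching d n) (b i)) ∧
      ∀ i j, i ≠ j → ¬ Conn d (ω \ touching d n) (b i) (b j)} =
          {ω : Config d | (∀ i, ConnInf d (ω \ touching d n) (b i)) ∧
      ∀ i j, i ≠ j → ¬ Conn d (ω \ touching d n) (b i) (b j)} :=
        Set.inter_eq_right.2 fun _ _ => hb
      rw [this]
      exact nonpos_iff_eq_zero.1 (hcon n b hb)
    · rw [Set.eq_empty_of_forall_notMem
        (s := {_ω : Config d | ((∀ i, b i ∉ box d n ∧ ∃ u ∈ box d n, (lattice d).Adj u (b i)) ∧ ∀ i j, i ≠ j → b i ≠ b j)}) fun _ h => hb h,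
        Set.empty_inter, measure_empty]
  exact h3.ne' (measure_mono_null atLeastInf_three_subset_iUnion hnull)

end Summit.Ventures.PercRepro0.ExtTails
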